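import Mathlib
import Literature.NumberTheory.Transcendental.KZCalculus

/-!
# `TateLifting` (stmt-KontsevichZagierPeriods-9129), line `Sketch` — stub `stub_ballValue`

VOLUMES OF THE UNIT BALLS (stub 62, the body of `BallValue`). For every dimension `n` and every
integral representation `b` whose domain is the closed unit ball in coordinates
`B̄ₙ = {v : ℝⁿ | ∑ⱼ vⱼ² ≤ 1}` and whose integrand is `1` on that domain, the represented number is
the volume of the ball:

* `b.value = ∫_{B̄ₙ} 1 = vol(B̄ₙ)` (`setIntegral_congr_fun`, `setIntegral_const`);
* `vol(B̄ₙ)` equals the volume of the closed unit ball of the Euclidean space `EuclideanSpace ℝ (Fin n)`,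
  transported along the volume-preserving identification `WithLp.toLp 2 : (Fin n → ℝ) → ℝⁿ`
  (`PiLp.volume_preserving_toLp`, `EuclideanSpace.closedBall_zero_eq`);
* `vol(B̄₂ₖ) = πᵏ/k!` and `vol(B̄₂ₖ₊₁) = πᵏ 2ᵏ⁺¹/(2k+1)‼`
  (`InnerProductSpace.volume_closedBall_of_dim_even/odd`; the `0`-dimensional ball is the point
  `ℝ⁰`, of volume `1 = π⁰/0!`).

References: M. Kontsevich, D. Zagier, *Periods* (2001), §1.1 (volumes of balls are the first
examples of periods).
-/

noncomputable section

open MeasureTheory Set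
open Literature.NumberTheory.Transcendental

namespace Summit.KontsevichZagierPeriods.InverseLandau

namespace BallValue

/-- The value of an integrand-`1` representation is the volume of its domain. [folklore] -/
theorem value_eq_toReal_volume {n : ℕ} (r : KZ.IntegralRep n)
    (hri : ∀ v ∈ r.domain, r.integrand v = 1) : r.value = (volume r.domain).toReal := by
  rw [KZ.IntegralRep.value, setIntegral_congr_fun (KZ.IntegralRep.measurableSet_domain_holds r) hri,
    setIntegral_const, smul_eq_mul, mul_one, measureReal_def]

/-- The closed unit ball in coordinates is the preimage of the closed unit ball of
`EuclideanSpace ℝ (Fin n)` under `WithLp.toLp 2`. [folklore] -/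
theorem setOf_sum_sq_le_one_eq_preimage (n : ℕ) :
    {v : Fin n → ℝ | ∑ j, v j ^ 2 ≤ 1} =
      (WithLp.toLp 2) ⁻¹' Metric.closedBall (0 : EuclideanSpace ℝ (Fin n)) 1 := by
  rw [EuclideanSpace.closedBall_zero_eq 1 zero_le_one, one_pow]
  ext v
  simp only [mem_setOf_eq, mem_preimage]

/-- The closed unit ball in coordinates has the volume of the Euclidean closed unit ball
(`WithLp.toLp 2` is volume preserving). [folklore] -/
theorem volume_setOf_sum_sq_le_one (n : ℕ) :
    volume {v : Fin n → ℝ | ∑ j, v j ^ 2 ≤ 1} =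
      volume (Metric.closedBall (0 : EuclideanSpace ℝ (Fin n)) 1) := by
  rw [setOf_sum_sq_le_one_eq_preimage,
    (PiLp.volume_preserving_toLp (Fin n)).measure_preimage
      Metric.isClosed_closedBall.measurableSet.nullMeasurableSet]

/-- **Even dimensions**: `vol(B̄₂ₖ) = πᵏ/k!` (for `k = 0` the ball is the point `ℝ⁰`, of volume
`1`). [folklore] -/
theorem toReal_volume_unitBall_even {n k : ℕ} (hn : n = 2 * k) :
    (volume {v : Fin n → ℝ | ∑ j, v j ^ 2 ≤ 1}).toReal = Real.pi ^ k / (Nat.factorial k : ℝ) := by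
  rcases Nat.eq_zero_or_pos k with rfl | hk
  · obtain rfl : n = 0 := hn
    have h : {v : Fin 0 → ℝ | ∑ j, v j ^ 2 ≤ 1} = univ := eq_univ_of_forall fun v => by simp
    rw [h, volume_pi, Measure.pi_univ]
    simp
  · subst hn
    haveI : Nontrivial (EuclideanSpace ℝ (Fin (2 * k))) :=
      Module.nontrivial_of_finrank_pos (R := ℝ) (by rw [finrank_euclideanSpace_fin]; omega)
    rw [volume_setOf_sum_sq_le_one,
      InnerProductSpace.volume_closedBall_of_dim_even (k := k) finrank_euclideanSpace_fin,
      ENNReal.ofReal_one, one_pow, one_mul, ENNReal.toReal_ofReal (by positivity)]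

/-- **Odd dimensions**: `vol(B̄₂ₖ₊₁) = πᵏ 2ᵏ⁺¹/(2k+1)‼`. [folklore] -/
theorem toReal_volume_unitBall_odd {n k : ℕ} (hn : n = 2 * k + 1) :
    (volume {v : Fin n → ℝ | ∑ j, v j ^ 2 ≤ 1}).toReal =
      Real.pi ^ k * 2 ^ (k + 1) / (Nat.doubleFactorial (2 * k + 1) : ℝ) := by
  subst hn
  rw [volume_setOf_sum_sq_le_one,
    InnerProductSpace.volume_closedBall_of_dim_odd (k := k) finrank_euclideanSpace_fin,
    ENNReal.ofReal_one, one_pow, one_mul, ENNReal.toReal_ofReal (by positivity),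
    finrank_euclideanSpace_fin]

end BallValue

open BallValue in
/-- **Volumes of the unit balls** (stub `stub_ballValue` of line `Sketch` for crux `TateLifting`):
the integrand-`1` representation over the closed unit ball `{v : ℝⁿ | ∑ⱼ vⱼ² ≤ 1}` has value
`πᵏ/k!` in dimension `n = 2k` and `πᵏ 2ᵏ⁺¹/(2k+1)‼` in dimension `n = 2k + 1` — the first examples
of periods in Kontsevich–Zagier. [cite: KontsevichZagier2001, §1.1] -/
theorem tateLifting_ballValue :
    (∀ (k : ℕ) (b : KZ.IntegralRep (2 * k)), b.domain = {v | ∑ j, v j ^ 2 ≤ 1} →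
      (∀ v ∈ b.domain, b.integrand v = 1) → b.value = Real.pi ^ k / (Nat.factorial k : ℝ)) ∧
    (∀ (k : ℕ) (b : KZ.IntegralRep (2 * k + 1)), b.domain = {v | ∑ j, v j ^ 2 ≤ 1} →
      (∀ v ∈ b.domain, b.integrand v = 1) →
      b.value = Real.pi ^ k * 2 ^ (k + 1) / (Nat.doubleFactorial (2 * k + 1) : ℝ)) := by
  refine ⟨fun k b hdom hbi => ?_, fun k b hdom hbi => ?_⟩
  · rw [value_eq_toReal_volume b hbi, hdom, toReal_volume_unitBall_even rfl]
  · rw [value_eq_toReal_volume b hbi, hdom, toReal_volume_unitBall_odd rfl]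

end Summit.KontsevichZagierPeriods.InverseLandau
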